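import Literature.MathematicalPhysics.QuantumFieldTheory.Balaban1983to89.B9Eq380KnitRowVariationY
import Literature.MathematicalPhysics.QuantumFieldTheory.Balaban1983to89.B9Cor35GCubeAvgPiece

/-!
# `Balaban1983to89.B9Eq381KnitCubeBoxKernelY` — T. Bałaban, *Propagators for lattice gauge theories in a background field*, Commun. Math. Phys. **99** (1985)
# 389–434 [Balaban1985BackgroundPropagators] (3.80)–(3.83) pp. 406–407, (3.13) p. 393, p. 409 l. 1–5: THE (3.81) KERNEL DATA OF THE CUBE SEQUENCE's KNIT PAIR
# `(QknitCubeY i □, QsknitCubeY i □)` — sizes of the box kernel `boxKP` at a pair, its support geometry at the index bonds of `{Ω_n(□)}` (level window,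
# `ℓ + 3` to the carrier block, column mass `≤ 4(d+1)(L^{(d+1)n})⁻¹`), and the COLUMNS of the adjoint letter's variation `Q*_□(Ṽ) − Q*_□(1)`

statement-level skeleton of published theorems with citation tags; proofs where landed; nothing here is a claim about the Yang–Mills mass gap

THE PRINT.  [B9] p. 406 (3.80)–(3.81): *«Q_j(U′U) = Q_j(U) + F_{2,j}(A) … |F_{2,j}(A)A′| ≦ O(1)α₁Q″_j|A′| … We have a similar expansion for Q*_j(U′U), i.e.
Q*_j(U′U) = Q*_j(U) + F*_{2,j}(A), and F*_{2,j}(A) satisfies (3.81). (Let us notice that for complex configurations A the operator F*_{2,j}(A) is not the adjoint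
of F_{2,j}(A).)»*; p. 407 (3.83): *«It is a semi-local operator in the sense that the value (P₂(A)A′)(b) at a bond b ∈ B_j(Λ_j) depends on A, A′ restricted to
j-blocks neighbouring the block containing the bond b»*; (3.13) p. 393 («Q* the adjoint of Q»); p. 409 l. 1–5 (the operators of the cube sequence `{Ω_n(□)}`);
[4] = [Balaban1984PropagatorsII] (2.2)–(2.4) p. 224 (index bonds and levels), (2.46) p. 231 (block distance), (2.51) p. 232; [5] = [Balaban1985Averaging]
(139)–(147) pp. 39–40 (`Q″_j`), p. 24 (locality: the double block `Bʲ(c₋) ∪ Bʲ(c₊)`).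

WHY THIS FILE (cell `pub-ymgap`, node N06, seat dag-n06-j g40; piece (t57) part 1).  ✓`B9Eq380KnitRowVariationY.norm_QknitCubeY_mulY_sub_apply_le` (g39) is
(3.80)–(3.81) for the cube sequence's knit averaging in ROW form with the pair box kernel `boxKP i ι.1 f`.  Packaging the knit-pair averaging piece
`avgPieceCKnit` (✓`B9Cor35GDirAtKnitCubeLetters`) into dag-n06-c's `hAv` slot (`B9Cor35GDirAtCubeLetters.h385_dirB_of_pieces`, a [4] (2.51) block majorant
`κ₂α₁(len)⁻²e^{−δd}`) needs the KERNEL DATA of that row form at the cube sequence's index bonds — exactly what r05 used for the straight pair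
(`B9Cor35GCubeAvgPiece` §2: `lvl_window`, `dist_beta_blkV1_le`, `sum_qKc_col_le_plateau`) — and the COLUMN form of the adjoint's variation.  THIS FILE supplies
them: §1 the sizes of `boxKP` at a PAIR (dag-n06-l's member lemmas `B9Eq3115KnitLetterYRowCloseness.card_fiber_le_one ∕ boxK_le ∕ sum_boxK_le ∕
iterBlockOf_of_boxK_ne_zero` RE-PRESSED at `p : Σ j, PBond _ j`, so that the cube sequence's index bonds inherit them through `ι.1`); §2 the support geometry at
`ι : IBondCubeY i □` (r05's shapes from the ENDS predicate `f₋ ∈ Bʲ(ι₋) ∪ Bʲ(ι₊)`, the per-level and total column mass of `boxKP`); §3 the adjoint: the generic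
`X ∕ Y` twin of dag-n06-l's Summits-side `norm_adjTrY_apply_le_of_rowKernel` (a Literature file cannot import it) and the columns of `Q*_□(Ṽ) − Q*_□(1) =
adjTrY (Q_□(Ṽ) − Q_□(1))` on the hypotheses of the g39 engine at `U := 1`.

WHAT IS PROVED (sorry-free; 0 `def`; theorems only).
* §1 `lvlP_le`, `two_mul_pow_le_sitesPerDir_P`, `sub_lo_bounds_P`, `val_sub_transl_lo_P`, `eq_of_transl_eq_of_inBox_P`, ★ `card_fiber_le_one_P`, ★ `boxKP_le`
  (`boxKP p f ≤ (Lʲ)^{−(d+1)}`), ★ `sum_boxKP_le` (`Σ_f boxKP p f ≤ 2(d+1)`), ★ `ends_of_boxKP_ne_zero` (`boxKP p f ≠ 0 ⟹ Bʲ(f₋) ∈ {c₋, c₊}`).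
* §2 `ibondC_ext`, ★ `lvl_window_of_ends` ∕ `dist_beta_blkV1_le_of_ends` (r05's `lvl_window` ∕ `dist_beta_blkV1_le` from the ends predicate), `dist_blkV1_le_of_ends_ends`
  (`≤ 2ℓ + 6`), the `boxKP` instances `lvl_window_boxKP` ∕ `dist_beta_blkV1_le_boxKP`, ★★ `sum_filter_lvl_boxKP_le` (`Σ_{lvl ι = J} boxKP ι.1 f ≤ 2(d+1)·((L^{d+1})^J)⁻¹`), ★★
  `sum_boxKP_col_le_plateau` (`Σ_ι boxKP ι.1 f ≤ 4(d+1)·((L^{d+1})^{n(f)})⁻¹`, only the levels `n, n+1` see `f`).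
* §3 `norm_liftMatY_apply_le`, ★ `norm_adjTrY_apply_le_of_rowKernel_gen` (`‖(T a)(y)‖ ≤ Σ_x k y x‖a x‖ ⟹ ‖(adjTrY T Ψ)(x)‖ ≤ N⁴Σ_y k y x‖Ψ y‖`),
  ★ `norm_QsknitCubeY_one_apply_le` (`‖(Q*_□(1)Ψ)(f)‖ ≤ Σ_ι qKc ι f‖Ψ ι‖`), ★★ `norm_QsknitCubeY_sub_one_apply_le_of_rowKernel` (columns of `Q*_□(Ṽ) − Q*_□(1)` from ANY
  row kernel of `Q_□(Ṽ) − Q_□(1)`).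
HONEST SCOPE.  Finite-lattice bookkeeping; no estimate of [B9] beyond the displayed row kernel; the (3.83) block majorant itself is the NEXT file
(`B9Cor35GDirKnitAvgPieceMajorant`).  COUNT-NEUTRAL (`--supports stmt-QuantumFields-27364`); N06 NOT discharged; K1⁹ NOT closed; nothing continuum ∕ ℝ⁴ ∕ OS ∕
mass gap ∕ Clay — the Yang–Mills mass gap is NOT proved here.  NEW file; nothing landed is modified.  No `sorry`, no `axiom`, no `instance`, no `notation`.  Net new
unproved facts: 0.  Seat `pub-ymgap-dag-n06-j` (g40), 2026-08-31.
RELATED, NOT DUPLICATED (searched 2026-08-31: `rg 'boxKP_le|card_fiber_le_one_P|sum_filter_lvl_boxKP|sum_boxKP_col|norm_QsknitCubeY_sub_one'` over `Literature ∕ Summits`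
= ∅): dag-n06-l `B9Eq3115KnitLetterYRowCloseness` §1 (the MEMBER's `ι : IBondY i`; proofs re-pressed here at the pair, credited line by line), r05 `B9Cor35GCubeAvgPiece` §2
(the straight kernel `qKc`; USED BY NAME), dag-n06-l `Summits/…/BalabanUVNodesN06Thm312313ParLawsQStar.norm_adjTrY_apply_le_of_rowKernel` (member-typed, Summits-side).
-/

noncomputable section

namespace Literature.MathematicalPhysics.QuantumFieldTheory.Balaban1983to89.B9Eq381KnitCubeBoxKernelY

open scoped BigOperators
open B7Prop1Explicit renaming Site → LSite
open B7Prop1Explicit (e)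
open B7Prop1Local (InBox loK bondHiK)
open B7Prop5Flat (bondsIn mem_bondsIn boxFinset)
open B7Prop5FlatOperator (card_boxFinset_K card_bondsIn_le)
open B10Eq27TorusAxialLog (transl transl_apply transl_add_e)
open B5Eq118OneStroke (iterBlockOf)
open B6GlobalChartV1 (PV)
open B6GlobalChartV1L0 (blkV1)
open B6KLevelCensusIndexV1 (KIdx kGeo)
open B6Cover236MultiLevelBlocks (cubes)
open B9CubeLettersOpsL0 (cubeFamY)
open B9CubeLettersBondOpsL0 (IBondCubeY BlkCubeY qKc qsKc)
open B9CubeLettersCovarianceL0 (qsKc_eq_transpose)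
open B9CubeGeometryInputs (geoCK)
open B9Eq383CubeLetters (qKc_nonneg)
open B9Eq3115KnitCubeLetterY (zSrcP transl_zero_zSrcP QknitCubeY QsknitCubeY QsknitCubeY_apply QsknitCubeY_one)
open B9Eq3115KnitLetterYFarFace (iterBlockOf_transl_zero blk_of_inBox_bond)
open B9Eq380KnitRowVariationY (loP hiP boxKP boxKP_nonneg sum_boxKP_mul_eq end_block_of_mem_bondsIn_P)
open B9Cor35GCubeAvgPiece (blkV1_level)
open Node00
open Node00.OpsYQLetter (adjTrY adjTrY_apply trSesqY unitFnY)

variable {d ℓ : ℕ} {hd : 1 ≤ d + 1} {hL : Odd (ℓ + 1) ∧ 1 < ℓ + 1} {b₀ b₁ : ℝ}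

/-! ## §1 The box kernel at a pair: fibres, sizes, and the ends predicate (dag-n06-l's member lemmas at `p : Σ j, PBond _ j`) -/

section Pair

variable (i : KIdx d ℓ hd hL b₀ b₁)

/-- the level of a pair is at most `m + K`. [cite: Balaban1984PropagatorsII, (2.1) p.224, bookkeeping] -/
theorem lvlP_le (p : (j : Fin (i.k + 1)) × PBond (PV d ℓ i.m i.K hd hL) (j : ℕ)) : (p.1 : ℕ) ≤ i.m + i.K :=
  (Nat.le_of_lt_succ p.1.2).trans i.hk

/-- `2Lʲ ≤ N₀` for every pair level `j ≤ k ≤ m + K` (dag-n06-l's `two_mul_pow_le_sitesPerDir` at the pair). [cite: Balaban1984PropagatorsII, (2.1) p.224; Balaban1985Averaging, p.24, bookkeeping] -/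
theorem two_mul_pow_le_sitesPerDir_P (p : (j : Fin (i.k + 1)) × PBond (PV d ℓ i.m i.K hd hL) (j : ℕ)) :
    2 * ((((ℓ + 1 : ℕ) : ℤ)) ^ (p.1 : ℕ)) ≤ ((((PV d ℓ i.m i.K hd hL).sitesPerDir 0 : ℕ) : ℤ)) := by
  have hj : (p.1 : ℕ) ≤ i.m + i.K := lvlP_le i p
  have h1 : (ℓ + 1) ^ (p.1 : ℕ) ≤ (ℓ + 1) ^ (i.m + i.K) := Nat.pow_le_pow_right (Nat.succ_pos ℓ) hj
  have h2 : (PV d ℓ i.m i.K hd hL).sitesPerDir 0 = 2 * (ℓ + 1) ^ (i.m + i.K) := by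
    show 2 * (ℓ + 1) ^ (i.m + i.K - 0) = _; rw [Nat.sub_zero]
  rw [h2]; push_cast
  have : (((ℓ + 1 : ℕ) : ℤ)) ^ (p.1 : ℕ) ≤ (((ℓ : ℤ) + 1)) ^ (i.m + i.K) := by exact_mod_cast h1
  push_cast at this
  linarith

/-- a point of the double box of `p` is within `2Lʲ − 1 < N₀` of the corner, coordinatewise (dag-n06-l's `sub_lo_bounds` at the pair).
[cite: Balaban1985Averaging, p.24 («Bᵏ(c₋) ∪ Bᵏ(c₊)»), bookkeeping] -/
theorem sub_lo_bounds_P (p : (j : Fin (i.k + 1)) × PBond (PV d ℓ i.m i.K hd hL) (j : ℕ)) {x : LSite (d + 1)}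
    (hx : InBox (loP i p) (hiP i p) x) (ν : Fin (d + 1)) :
    0 ≤ x ν - loP i p ν ∧ x ν - loP i p ν < ((((PV d ℓ i.m i.K hd hL).sitesPerDir 0 : ℕ) : ℤ)) := by
  have h2N := two_mul_pow_le_sitesPerDir_P i p
  obtain ⟨h1, h2⟩ := hx ν
  simp only [loP, hiP, loK, bondHiK] at h1 h2 ⊢
  push_cast at h1 h2 h2N ⊢
  refine ⟨by linarith, ?_⟩
  have hP : (0 : ℤ) < ((ℓ : ℤ) + 1) ^ (p.1 : ℕ) := by positivity
  split_ifs at h2 <;> linarith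

/-- the torus displacement from the corner of an in-box point, read in `[0, N₀)`, IS its integer displacement (dag-n06-l's `val_sub_transl_lo` at the pair).
[cite: Balaban1984PropagatorsI, (1.6) p.18, bookkeeping] -/
theorem val_sub_transl_lo_P (p : (j : Fin (i.k + 1)) × PBond (PV d ℓ i.m i.K hd hL) (j : ℕ)) {x : LSite (d + 1)}
    (hx : InBox (loP i p) (hiP i p) x) (ν : Fin (d + 1)) :
    ((((transl (0 : Site (PV d ℓ i.m i.K hd hL) 0) x ν - transl (0 : Site (PV d ℓ i.m i.K hd hL) 0) (loP i p) ν).val : ℕ) : ℤ)) =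
      x ν - loP i p ν := by
  obtain ⟨h0, h2⟩ := sub_lo_bounds_P i p hx ν
  have h1 : transl (0 : Site (PV d ℓ i.m i.K hd hL) 0) x ν - transl (0 : Site (PV d ℓ i.m i.K hd hL) 0) (loP i p) ν =
      (((x ν - loP i p ν : ℤ)) : ZMod ((PV d ℓ i.m i.K hd hL).sitesPerDir 0)) := by
    rw [transl_apply, transl_apply]; push_cast; ring
  rw [h1, ZMod.val_intCast, Int.emod_eq_of_lt h0 h2]

/-- two in-box integer points with the same torus image are equal (dag-n06-l's `eq_of_transl_eq_of_inBox` at the pair). [cite: Balaban1984PropagatorsI, (1.6) p.18, bookkeeping] -/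
theorem eq_of_transl_eq_of_inBox_P (p : (j : Fin (i.k + 1)) × PBond (PV d ℓ i.m i.K hd hL) (j : ℕ)) {x x' : LSite (d + 1)}
    (hx : InBox (loP i p) (hiP i p) x) (hx' : InBox (loP i p) (hiP i p) x')
    (h : transl (0 : Site (PV d ℓ i.m i.K hd hL) 0) x = transl (0 : Site (PV d ℓ i.m i.K hd hL) 0) x') : x = x' := by
  funext ν
  have h1 := val_sub_transl_lo_P i p hx ν
  have h2 := val_sub_transl_lo_P i p hx' ν
  rw [h] at h1
  rw [h1] at h2
  linarith

/-- ★ **THE FIBRES OF THE BOX ⟶ TORUS MAP HAVE AT MOST ONE POINT** (dag-n06-l's `card_fiber_le_one` at the pair). [cite: Balaban1985Averaging, (139) p.39, p.24, bookkeeping] -/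
theorem card_fiber_le_one_P (p : (j : Fin (i.k + 1)) × PBond (PV d ℓ i.m i.K hd hL) (j : ℕ)) (f : FBondY i) :
    ((bondsIn (loP i p) (hiP i p)).filter fun s =>
      (⟨transl (0 : Site (PV d ℓ i.m i.K hd hL) 0) s.1, s.2⟩ : FBondY i) = f).card ≤ 1 := by
  classical
  refine Finset.card_le_one.2 fun s hs s' hs' => ?_
  obtain ⟨hsS, hsf⟩ := Finset.mem_filter.1 hs
  obtain ⟨hsS', hsf'⟩ := Finset.mem_filter.1 hs'
  have h := hsf.trans hsf'.symm
  have h1 : transl (0 : Site (PV d ℓ i.m i.K hd hL) 0) s.1 = transl (0 : Site (PV d ℓ i.m i.K hd hL) 0) s'.1 := congrArg PBond.src h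
  have h2 : s.2 = s'.2 := congrArg PBond.dir h
  exact Prod.ext (eq_of_transl_eq_of_inBox_P i p (mem_bondsIn.1 hsS).1 (mem_bondsIn.1 hsS').1 h1) h2

/-- ★ `boxKP p f ≤ (Lʲ)^{−(d+1)}` (dag-n06-l's `boxK_le` at the pair). [cite: Balaban1985Averaging, (139) p.39, bookkeeping] -/
theorem boxKP_le (p : (j : Fin (i.k + 1)) × PBond (PV d ℓ i.m i.K hd hL) (j : ℕ)) (f : FBondY i) :
    boxKP i p f ≤ (((((ℓ + 1 : ℕ) : ℝ)) ^ (p.1 : ℕ)) ^ (d + 1))⁻¹ := by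
  unfold boxKP
  have h := (Nat.cast_le (α := ℝ)).2 (card_fiber_le_one_P i p f)
  rw [Nat.cast_one] at h
  have hc : 0 ≤ (((((ℓ + 1 : ℕ) : ℝ)) ^ (p.1 : ℕ)) ^ (d + 1))⁻¹ := by positivity
  have := mul_le_mul_of_nonneg_left h hc
  rwa [mul_one] at this

/-- ★ **ROW MASS AT A PAIR** `Σ_f boxKP p f ≤ 2(d+1)` (the double box carries `≤ 2(d+1)(Lʲ)^{d+1}` bonds; dag-n06-l's `sum_boxK_le` at the pair).
[cite: Balaban1985Averaging, p.24, (140) p.39; Balaban1985BackgroundPropagators, (3.14) p.393] -/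
theorem sum_boxKP_le (p : (j : Fin (i.k + 1)) × PBond (PV d ℓ i.m i.K hd hL) (j : ℕ)) : ∑ f, boxKP i p f ≤ 2 * ((d : ℝ) + 1) := by
  have h := sum_boxKP_mul_eq i p fun _ => 1
  simp only [mul_one, Finset.sum_const, nsmul_eq_mul] at h
  rw [h]
  set S := bondsIn (loP i p) (hiP i p) with hS
  set Lj : ℝ := (((ℓ + 1 : ℕ) : ℝ)) ^ (p.1 : ℕ) with hLj
  have hLj0 : 0 < Lj := by positivity
  have hcard : S.card ≤ 2 * ((ℓ + 1) ^ (p.1 : ℕ)) ^ (d + 1) * (d + 1) := by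
    have h1 := card_bondsIn_le (loP i p) (hiP i p)
    have h2 : (boxFinset (loP i p) (hiP i p)).card = 2 * ((ℓ + 1) ^ (p.1 : ℕ)) ^ (d + 1) := card_boxFinset_K (ℓ + 1) (p.1 : ℕ) (zSrcP i p) p.2.dir
    rw [h2] at h1
    exact h1
  have hc : (S.card : ℝ) ≤ 2 * Lj ^ (d + 1) * ((d : ℝ) + 1) := by
    have := (Nat.cast_le (α := ℝ)).2 hcard
    rw [hLj]; push_cast at this ⊢; linarith
  calc (Lj ^ (d + 1))⁻¹ * (S.card : ℝ) ≤ (Lj ^ (d + 1))⁻¹ * (2 * Lj ^ (d + 1) * ((d : ℝ) + 1)) :=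
        mul_le_mul_of_nonneg_left hc (by positivity)
    _ = 2 * ((d : ℝ) + 1) := by field_simp

/-- ★ **THE ENDS PREDICATE OF THE BOX KERNEL**: `boxKP p f ≠ 0 ⟹` the `j`-block of `f₋` is `c₋` or `c₊` (dag-n06-l's `iterBlockOf_of_boxK_ne_zero` at the pair, through
✓`end_block_of_mem_bondsIn_P`). [cite: Balaban1984PropagatorsII, (2.2)–(2.4) p.224; Balaban1985Averaging, p.24] -/
theorem ends_of_boxKP_ne_zero (p : (j : Fin (i.k + 1)) × PBond (PV d ℓ i.m i.K hd hL) (j : ℕ)) {f : FBondY i} (h : boxKP i p f ≠ 0) :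
    iterBlockOf (p.1 : ℕ) f.src = p.2.src ∨ iterBlockOf (p.1 : ℕ) f.src = p.2.tgt := by
  classical
  unfold boxKP at h
  have hcard : ((bondsIn (loP i p) (hiP i p)).filter fun s =>
      (⟨transl (0 : Site (PV d ℓ i.m i.K hd hL) 0) s.1, s.2⟩ : FBondY i) = f) ≠ ∅ := by
    intro he; apply h; rw [he, Finset.card_empty, Nat.cast_zero, mul_zero]
  obtain ⟨s, hs⟩ := Finset.nonempty_iff_ne_empty.2 hcard
  obtain ⟨hsS, hsf⟩ := Finset.mem_filter.1 hs
  rw [← hsf]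
  exact end_block_of_mem_bondsIn_P i p hsS

end Pair

/-! ## §2 The support geometry of the box kernel at the index bonds of the cube sequence `{Ω_n(□)}` -/

section Cube

variable (i : KIdx d ℓ hd hL b₀ b₁) (q : ↥(cubes (toKT i).D.toDomains))

/-- two index bonds of the cube sequence with the same level, the same source labels and the same direction are equal (dag-n06-l's `ibond_ext`, cube-typed).
[cite: Balaban1984PropagatorsII, (2.3) p.224, bookkeeping] -/
theorem ibondC_ext {ι ι' : IBondCubeY i q} (hj : (ι'.1.1 : ℕ) = (ι.1.1 : ℕ)) (hs : ∀ μ, (ι'.1.2.src μ).val = (ι.1.2.src μ).val)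
    (hdir : ι'.1.2.dir = ι.1.2.dir) : ι' = ι := by
  obtain ⟨⟨j', b'⟩, p'⟩ := ι'
  obtain ⟨⟨j, b⟩, p⟩ := ι
  have hjj : j' = j := Fin.ext hj
  subst hjj
  obtain ⟨s', μ'⟩ := b'
  obtain ⟨s, μ⟩ := b
  simp only at hs hdir
  subst hdir
  have hss : s' = s := funext fun ν => ZMod.val_injective _ (hs ν)
  subst hss
  rfl

/-- ★ **THE LEVEL WINDOW FROM THE ENDS PREDICATE**: if the `j(ι)`-block of `f₋` is an end block of the cube index bond `ι`, the cube block of `f` has level `j − 1` or `j`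
([4] (2.2)–(2.4) for the cube sequence: `B6Ineq2142KLevelV1L0.lev_ends_bounds` at `cubeFamY i □`; r05's `lvl_window` is the `qKc` instance).
[cite: Balaban1984PropagatorsII, (2.2)–(2.4) p.224; Balaban1985BackgroundPropagators, p.409 l.3–5] -/
theorem lvl_window_of_ends {ι : IBondCubeY i q} {f : FBondY i}
    (h : iterBlockOf (ι.1.1 : ℕ) f.src = ι.1.2.src ∨ iterBlockOf (ι.1.1 : ℕ) f.src = ι.1.2.tgt) :
    (ι.1.1 : ℕ) - 1 ≤ (blkV1 i.hN (cubeFamY i q) f).1.1 ∧ (blkV1 i.hN (cubeFamY i q) f).1.1 ≤ (ι.1.1 : ℕ) := by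
  obtain ⟨-, -, -, -, hRM⟩ := B9CubeBondRowAgreementNearH.side_conds i
  have h1 := B6Ineq2142KLevelV1L0.lev_ends_bounds i.hN (cubeFamY i q) i.hk hRM ι h
  rw [blkV1_level]
  exact h1

/-- ★ **`ℓ + 3` TO THE CARRIER BLOCK FROM THE ENDS PREDICATE** (the V1 lineage's `geomT_dist_ends_le` at `cubeFamY i □`; r05's `dist_beta_blkV1_le` is the `qKc` instance).
[cite: Balaban1984PropagatorsII, (2.46) p.231, p.247; Balaban1985Averaging, p.24] -/
theorem dist_beta_blkV1_le_of_ends {ι : IBondCubeY i q} {f : FBondY i}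
    (h : iterBlockOf (ι.1.1 : ℕ) f.src = ι.1.2.src ∨ iterBlockOf (ι.1.1 : ℕ) f.src = ι.1.2.tgt) :
    (geoCK i q).dist (B6Ineq2142KLevelV1L0.β i.hN (cubeFamY i q) i.hk ι) (blkV1 i.hN (cubeFamY i q) f) ≤ (ℓ : ℝ) + 3 := by
  obtain ⟨-, -, -, -, hRM⟩ := B9CubeBondRowAgreementNearH.side_conds i
  exact B6Ineq2142KLevelV1L0.geomT_dist_ends_le i.hN (cubeFamY i q) i.hk hRM (toKT i).hMh (toKT i).hP ι h

/-- ★ **TWO FINE BONDS WHOSE SOURCE BLOCKS ARE ENDS OF A COMMON INDEX BOND ARE WITHIN `2(ℓ + 3)` IN THE BLOCK GRAPH** — the semi-locality of `P₂(A)` at the knit pair.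
[cite: Balaban1985BackgroundPropagators, (3.83) p.407; Balaban1984PropagatorsII, (2.46) p.231] -/
theorem dist_blkV1_le_of_ends_ends {ι : IBondCubeY i q} {f f' : FBondY i}
    (h : iterBlockOf (ι.1.1 : ℕ) f.src = ι.1.2.src ∨ iterBlockOf (ι.1.1 : ℕ) f.src = ι.1.2.tgt)
    (h' : iterBlockOf (ι.1.1 : ℕ) f'.src = ι.1.2.src ∨ iterBlockOf (ι.1.1 : ℕ) f'.src = ι.1.2.tgt) :
    (geoCK i q).dist (blkV1 i.hN (cubeFamY i q) f) (blkV1 i.hN (cubeFamY i q) f') ≤ 2 * (ℓ : ℝ) + 6 := by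
  obtain ⟨-, htri, -, hsym⟩ := B9CubeGeometryInputs.geoCK_dist_axioms i q 0 True
  have h1 := dist_beta_blkV1_le_of_ends i q h
  have h2 := dist_beta_blkV1_le_of_ends i q h'
  rw [hsym] at h1
  have t := htri (blkV1 i.hN (cubeFamY i q) f) (B6Ineq2142KLevelV1L0.β i.hN (cubeFamY i q) i.hk ι) (blkV1 i.hN (cubeFamY i q) f')
  change (geoCK i q).dist _ _ ≤ (geoCK i q).dist _ _ + (geoCK i q).dist _ _ at t
  linarith

/-- the level window of the box kernel at a cube index bond. [cite: Balaban1984PropagatorsII, (2.2)–(2.4) p.224; Balaban1985Averaging, p.24] -/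
theorem lvl_window_boxKP {ι : IBondCubeY i q} {f : FBondY i} (h : boxKP i ι.1 f ≠ 0) :
    (ι.1.1 : ℕ) - 1 ≤ (blkV1 i.hN (cubeFamY i q) f).1.1 ∧ (blkV1 i.hN (cubeFamY i q) f).1.1 ≤ (ι.1.1 : ℕ) :=
  lvl_window_of_ends i q (ends_of_boxKP_ne_zero i ι.1 h)

/-- the box kernel's double support is within `ℓ + 3` of the carrier block. [cite: Balaban1984PropagatorsII, (2.46) p.231; Balaban1985Averaging, p.24] -/
theorem dist_beta_blkV1_le_boxKP {ι : IBondCubeY i q} {f : FBondY i} (h : boxKP i ι.1 f ≠ 0) :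
    (geoCK i q).dist (B6Ineq2142KLevelV1L0.β i.hN (cubeFamY i q) i.hk ι) (blkV1 i.hN (cubeFamY i q) f) ≤ (ℓ : ℝ) + 3 :=
  dist_beta_blkV1_le_of_ends i q (ends_of_boxKP_ne_zero i ι.1 h)

open Classical in
/-- `(x + e_μ) − e_μ = x` on the torus. [folklore] -/
private theorem unshift_shift' {P : Params} {j : ℕ} (x : Site P j) (μ : Fin P.d) : (x.shift μ).unshift μ = x := by
  funext ν
  by_cases h : ν = μ
  · subst h; simp [Site.shift, Site.unshift]
  · simp [Site.shift, Site.unshift, h]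

/-- ★★ **COLUMN MASS PER LEVEL AT THE CUBE SEQUENCE** `Σ_{lvl ι = J} boxKP ι.1 f ≤ 2(d+1)·((L^{d+1})^J)⁻¹`: at most `2(d+1)` index bonds of `{Ω_n(□)}` of a level have `f₋` in an
end block (level, source labels and direction determine an index bond), each contributing `≤ vol_J⁻¹` (dag-n06-l's `sum_filter_lvl_boxK_le`, cube-typed).
[cite: Balaban1984PropagatorsI, (1.18) p.20; Balaban1984PropagatorsII, (2.3) p.224; Balaban1985Averaging, (139)–(141) p.39] -/
theorem sum_filter_lvl_boxKP_le (J : ℕ) (f : FBondY i) :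
    ∑ ι ∈ Finset.univ.filter (fun ι : IBondCubeY i q => (ι.1.1 : ℕ) = J), boxKP i ι.1 f
      ≤ 2 * ((d : ℝ) + 1) * ((((((ℓ + 1 : ℕ) : ℝ)) ^ (d + 1)) ^ J)⁻¹) := by
  classical
  set F := Finset.univ.filter (fun ι : IBondCubeY i q => (ι.1.1 : ℕ) = J) with hF
  set A := F.filter (fun ι => iterBlockOf (ι.1.1 : ℕ) f.src = ι.1.2.src) with hA
  set B := F.filter (fun ι => iterBlockOf (ι.1.1 : ℕ) f.src = ι.1.2.tgt) with hB
  have hlvl : ∀ ι ∈ F, (ι.1.1 : ℕ) = J := fun ι hι => (Finset.mem_filter.1 hι).2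
  -- only `A ∪ B` contributes
  have hsub : A ∪ B ⊆ F := Finset.union_subset (Finset.filter_subset _ _) (Finset.filter_subset _ _)
  have hsplit : ∑ ι ∈ F, boxKP i ι.1 f = ∑ ι ∈ A ∪ B, boxKP i ι.1 f := by
    refine (Finset.sum_subset hsub fun ι hιF hι => ?_).symm
    by_contra hne
    rcases ends_of_boxKP_ne_zero i ι.1 hne with h | h
    · exact hι (Finset.mem_union_left _ (Finset.mem_filter.2 ⟨hιF, h⟩))
    · exact hι (Finset.mem_union_right _ (Finset.mem_filter.2 ⟨hιF, h⟩))
  -- the direction is injective on `A` and on `B`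
  have hcardA : A.card ≤ d + 1 := by
    have hinj : Set.InjOn (fun ι : IBondCubeY i q => ι.1.2.dir) ↑A := by
      intro ι hι ι' hι' hdir
      obtain ⟨hιF, hι⟩ := Finset.mem_filter.1 (Finset.mem_coe.1 hι)
      obtain ⟨hιF', hι'⟩ := Finset.mem_filter.1 (Finset.mem_coe.1 hι')
      have hjj : (ι'.1.1 : ℕ) = (ι.1.1 : ℕ) := by rw [hlvl ι hιF, hlvl ι' hιF']
      refine (ibondC_ext i q hjj (fun μ => ?_) hdir.symm).symm
      rw [← hι, ← hι']
      exact congrArg (fun n : ℕ => ((iterBlockOf n f.src μ).val : ℕ)) hjj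
    have h := Finset.card_le_card_of_injOn (fun ι : IBondCubeY i q => ι.1.2.dir) (fun _ _ => Finset.mem_univ _) hinj
    simpa using h
  have hcardB : B.card ≤ d + 1 := by
    have hinj : Set.InjOn (fun ι : IBondCubeY i q => ι.1.2.dir) ↑B := by
      intro ι hι ι' hι' hdir
      obtain ⟨hιF, hι⟩ := Finset.mem_filter.1 (Finset.mem_coe.1 hι)
      obtain ⟨hιF', hι'⟩ := Finset.mem_filter.1 (Finset.mem_coe.1 hι')
      have hjj : (ι'.1.1 : ℕ) = (ι.1.1 : ℕ) := by rw [hlvl ι hιF, hlvl ι' hιF']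
      have hs : ι.1.2.src = (iterBlockOf (ι.1.1 : ℕ) f.src).unshift ι.1.2.dir := by
        rw [hι]; exact (unshift_shift' _ _).symm
      have hs' : ι'.1.2.src = (iterBlockOf (ι'.1.1 : ℕ) f.src).unshift ι'.1.2.dir := by
        rw [hι']; exact (unshift_shift' _ _).symm
      refine (ibondC_ext i q hjj (fun μ => ?_) hdir.symm).symm
      simp only at hdir
      rw [hs, hs', hdir]
      exact congrArg (fun n : ℕ => (((iterBlockOf n f.src).unshift ι'.1.2.dir μ).val : ℕ)) hjj
    have h := Finset.card_le_card_of_injOn (fun ι : IBondCubeY i q => ι.1.2.dir) (fun _ _ => Finset.mem_univ _) hinj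
    simpa using h
  -- each contributing index bond weighs at most `vol_J⁻¹`
  set vJ : ℝ := ((((((ℓ + 1 : ℕ) : ℝ)) ^ (d + 1)) ^ J)⁻¹) with hvJ
  have hterm : ∀ ι ∈ A ∪ B, boxKP i ι.1 f ≤ vJ := by
    intro ι hι
    have hJ : (ι.1.1 : ℕ) = J := hlvl ι (hsub hι)
    have h := boxKP_le i ι.1 f
    rw [hJ, ← pow_mul, mul_comm, pow_mul] at h
    exact h
  have hcardAB : ((A ∪ B).card : ℝ) ≤ 2 * ((d : ℝ) + 1) := by
    have h1 := Finset.card_union_le A B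
    have : ((A ∪ B).card : ℝ) ≤ ((A.card + B.card : ℕ) : ℝ) := by exact_mod_cast h1
    have hA' : (A.card : ℝ) ≤ (d : ℝ) + 1 := by exact_mod_cast hcardA
    have hB' : (B.card : ℝ) ≤ (d : ℝ) + 1 := by exact_mod_cast hcardB
    push_cast at this; linarith
  have hvJ0 : 0 ≤ vJ := by positivity
  calc ∑ ι ∈ F, boxKP i ι.1 f = ∑ ι ∈ A ∪ B, boxKP i ι.1 f := hsplit
    _ ≤ ∑ ι ∈ A ∪ B, vJ := Finset.sum_le_sum hterm
    _ = (A ∪ B).card * vJ := by rw [Finset.sum_const, nsmul_eq_mul]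
    _ ≤ 2 * ((d : ℝ) + 1) * vJ := mul_le_mul_of_nonneg_right hcardAB hvJ0

open Classical in
/-- ★★ **THE COLUMN MASS OF THE BOX KERNEL AT A FINE BOND IN A CUBE BLOCK OF LEVEL `n` IS `≤ 4(d+1)·L^{−n(d+1)}`**: only the levels `n`, `n + 1` see it (level window),
each with column mass `≤ 2(d+1)` times its plateau (the `boxKP` twin of r05's `sum_qKc_col_le_plateau`).
[cite: Balaban1985Averaging, (139)–(141) p.39, p.24; Balaban1984PropagatorsII, (2.2)–(2.4) p.224, (2.20) p.226; Balaban1985BackgroundPropagators, (3.81) p.406, p.409 l.1–5] -/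
theorem sum_boxKP_col_le_plateau (f : FBondY i) :
    ∑ ι : IBondCubeY i q, boxKP i ι.1 f ≤ 4 * ((d : ℝ) + 1) * ((((ℓ + 1 : ℕ) : ℝ) ^ (d + 1)) ^ (blkV1 i.hN (cubeFamY i q) f).1.1)⁻¹ := by
  set n := (blkV1 i.hN (cubeFamY i q) f).1.1 with hn
  have hmaps : ∀ ι ∈ (Finset.univ : Finset (IBondCubeY i q)), (ι.1.1 : ℕ) ∈ Finset.range (i.k + 1) :=
    fun ι _ => Finset.mem_range.2 ι.1.1.2
  rw [← Finset.sum_fiberwise_of_maps_to hmaps]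
  have hL1 : (1 : ℝ) ≤ ((ℓ + 1 : ℕ) : ℝ) ^ (d + 1) := one_le_pow₀ (by exact_mod_cast Nat.succ_le_succ (Nat.zero_le ℓ))
  have hd0 : (0 : ℝ) ≤ 2 * ((d : ℝ) + 1) := by positivity
  -- each level contributes at most `2(d+1)` times its plateau, and only the levels `n`, `n+1` contribute at all
  have hlvl : ∀ J ∈ Finset.range (i.k + 1),
      ∑ ι ∈ Finset.univ.filter (fun ι : IBondCubeY i q => (ι.1.1 : ℕ) = J), boxKP i ι.1 f ≤
        if J = n ∨ J = n + 1 then 2 * ((d : ℝ) + 1) * ((((ℓ + 1 : ℕ) : ℝ) ^ (d + 1)) ^ J)⁻¹ else 0 := by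
    intro J _
    split_ifs with hJ
    · exact sum_filter_lvl_boxKP_le i q J f
    · refine (Finset.sum_eq_zero fun ι hι => ?_).le
      rw [Finset.mem_filter] at hι
      by_contra hne
      have hw := lvl_window_boxKP i q hne
      rw [hι.2] at hw
      omega
  refine (Finset.sum_le_sum hlvl).trans ?_
  have hsplit : ∑ J ∈ Finset.range (i.k + 1), (if J = n ∨ J = n + 1 then 2 * ((d : ℝ) + 1) * ((((ℓ + 1 : ℕ) : ℝ) ^ (d + 1)) ^ J)⁻¹ else 0) ≤
      2 * ((d : ℝ) + 1) * ((((ℓ + 1 : ℕ) : ℝ) ^ (d + 1)) ^ n)⁻¹ + 2 * ((d : ℝ) + 1) * ((((ℓ + 1 : ℕ) : ℝ) ^ (d + 1)) ^ (n + 1))⁻¹ := by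
    have hsub : ∑ J ∈ Finset.range (i.k + 1), (if J = n ∨ J = n + 1 then 2 * ((d : ℝ) + 1) * ((((ℓ + 1 : ℕ) : ℝ) ^ (d + 1)) ^ J)⁻¹ else 0) ≤
        ∑ J ∈ ({n, n + 1} : Finset ℕ), 2 * ((d : ℝ) + 1) * ((((ℓ + 1 : ℕ) : ℝ) ^ (d + 1)) ^ J)⁻¹ := by
      rw [← Finset.sum_filter]
      refine Finset.sum_le_sum_of_subset_of_nonneg (fun J hJ => ?_) (fun J _ _ => by positivity)
      rw [Finset.mem_filter] at hJ
      rcases hJ.2 with h | h <;> simp [h]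
    refine hsub.trans (le_of_eq ?_)
    rw [Finset.sum_pair (by omega)]
  refine hsplit.trans ?_
  have hmono : ((((ℓ + 1 : ℕ) : ℝ) ^ (d + 1)) ^ (n + 1))⁻¹ ≤ ((((ℓ + 1 : ℕ) : ℝ) ^ (d + 1)) ^ n)⁻¹ := by
    apply inv_anti₀ (by positivity)
    rw [pow_succ]
    exact le_mul_of_one_le_right (by positivity) hL1
  nlinarith

end Cube

/-! ## §3 The adjoint letter: columns of `Q*_□(1) = (qsKc)♯` and of the variation `Q*_□(Ṽ) − Q*_□(1) = adjTrY (Q_□(Ṽ) − Q_□(1))` -/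

section Fibre

open scoped Matrix Matrix.Norms.L2Operator

variable {N : ℕ}

/-- an entry is bounded by the `L²`-operator norm (adapted from dag-n06-l's Summits-side `BalabanUVNodesN06Thm312313ParLawsQStar`, private there).
[cite: Balaban1985BackgroundPropagators, p.389 (matrix-valued functions), bookkeeping] -/
private theorem norm_entry_le_l2_opNorm (A : Matrix (Fin N) (Fin N) ℂ) (a a' : Fin N) : ‖A a a'‖ ≤ ‖A‖ := by
  have h := Matrix.l2_opNorm_mulVec A (EuclideanSpace.single a' (1 : ℂ))
  have h1 : ‖(EuclideanSpace.single a' (1 : ℂ))‖ = 1 := by simp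
  rw [h1, mul_one] at h
  refine le_trans ?_ h
  refine le_trans (le_of_eq ?_) (PiLp.norm_apply_le _ a)
  simp

/-- a matrix unit `E_{pq}(c)` has operator norm `≤ ‖c‖`. [cite: Balaban1985BackgroundPropagators, p.389 (matrix units), bookkeeping] -/
private theorem l2_opNorm_single_le (p q : Fin N) (c : ℂ) : ‖Matrix.single p q c‖ ≤ ‖c‖ := by
  set T := Matrix.toEuclideanCLM (n := Fin N) (𝕜 := ℂ) (Matrix.single p q c)
  rw [← Matrix.l2_opNorm_toEuclideanCLM]
  refine T.opNorm_le_bound (norm_nonneg c) fun y => ?_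
  have hmv : ∀ w : Fin N → ℂ, Matrix.single p q c *ᵥ w = Pi.single p (c * w q) := by
    intro w
    funext i
    simp only [Matrix.mulVec, dotProduct, Matrix.single_apply]
    by_cases hi : i = p
    · subst hi
      rw [Pi.single_eq_same, Finset.sum_eq_single q]
      · rw [if_pos ⟨rfl, rfl⟩]
      · intro j _ hj; rw [if_neg (fun h => hj h.2.symm), zero_mul]
      · intro h; exact absurd (Finset.mem_univ _) h
    · rw [Pi.single_eq_of_ne hi]
      exact Finset.sum_eq_zero fun j _ => by rw [if_neg (fun h => hi h.1.symm), zero_mul]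
  have hT : T y = EuclideanSpace.single p (c * y q) := by
    apply (WithLp.ofLp_injective (p := 2))
    rw [Matrix.ofLp_toEuclideanCLM, hmv]
    rfl
  rw [hT]
  calc ‖EuclideanSpace.single p (c * y q)‖ = ‖c * y q‖ := by simp
    _ = ‖c‖ * ‖y q‖ := norm_mul _ _
    _ ≤ ‖c‖ * ‖y‖ := mul_le_mul_of_nonneg_left (PiLp.norm_apply_le y q) (norm_nonneg c)

/-- the operator norm is at most the sum of the entries' moduli. [cite: Balaban1985BackgroundPropagators, p.389, bookkeeping] -/
private theorem l2_opNorm_le_sum_norm_entry (M : Matrix (Fin N) (Fin N) ℂ) : ‖M‖ ≤ ∑ p, ∑ q, ‖M p q‖ := by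
  conv_lhs => rw [Matrix.matrix_eq_sum_single M]
  exact (norm_sum_le _ _).trans (Finset.sum_le_sum fun p _ => (norm_sum_le _ _).trans
    (Finset.sum_le_sum fun q _ => l2_opNorm_single_le p q (M p q)))

end Fibre

section Adjoint

open scoped Matrix Matrix.Norms.L2Operator

variable {N : ℕ} {X Y : Type} [Fintype X] [Fintype Y] [DecidableEq X]

omit [DecidableEq X] [Fintype Y] in
/-- **THE ROWS OF A REAL-KERNEL LIFT**: `‖(M♯ Λ)(y)‖ ≤ Σ_x |M y x|·‖Λ x‖`. [cite: Balaban1985BackgroundPropagators, (3.12) p.392 («Q(1) = Q»), bookkeeping] -/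
theorem norm_liftMatY_apply_le {𝔸 : Type} [NormedRing 𝔸] [NormedAlgebra ℂ 𝔸] (M : Matrix Y X ℝ) (Λ : X → 𝔸) (y : Y) :
    ‖liftMatY 𝔸 M Λ y‖ ≤ ∑ x, |M y x| * ‖Λ x‖ := by
  rw [liftMatY_apply]
  refine (norm_sum_le _ _).trans (Finset.sum_le_sum fun x _ => ?_)
  rw [norm_smul, Complex.norm_real, Real.norm_eq_abs]

/-- ★ **THE TRACE-PAIRING ADJOINT OF A ROW-MAJORISED LETTER IS COLUMN-MAJORISED** (generic carriers `X`, `Y`): if `‖(T a)(y)‖ ≤ Σ_x k y x·‖a x‖` (`k ≥ 0`) then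
`‖(adjTrY T Ψ)(x)‖ ≤ N⁴·Σ_y k y x·‖Ψ y‖` — the `(a,b)` entry of `(adjTrY T Ψ)(x)` is `Σ_y tr((T δ_x E_{ab})(y)ᴴ Ψ(y))`, entries are `≤` the operator norm, `‖E_{ab}‖ ≤ 1`
(dag-n06-l's member-typed `norm_adjTrY_apply_le_of_rowKernel`, proof verbatim). [cite: Balaban1985BackgroundPropagators, (3.11)–(3.13) p.393 («Q* the adjoint of Q»), bookkeeping] -/
theorem norm_adjTrY_apply_le_of_rowKernel_gen (T : (X → Matrix (Fin N) (Fin N) ℂ) →ₗ[ℂ] (Y → Matrix (Fin N) (Fin N) ℂ))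
    (k : Y → X → ℝ) (hk : ∀ y x, 0 ≤ k y x)
    (hrow : ∀ (a : X → Matrix (Fin N) (Fin N) ℂ) (y : Y), ‖T a y‖ ≤ ∑ x, k y x * ‖a x‖)
    (Ψ : Y → Matrix (Fin N) (Fin N) ℂ) (x : X) :
    ‖adjTrY T Ψ x‖ ≤ (N : ℝ) ^ 4 * ∑ y, k y x * ‖Ψ y‖ := by
  classical
  -- the image of a matrix unit at `x` has `y`-th value of norm `≤ k y x`
  have hTunit : ∀ (a b : Fin N) (y : Y), ‖T (unitFnY x a b) y‖ ≤ k y x := by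
    intro a b y
    refine (hrow _ y).trans ?_
    rw [Finset.sum_eq_single x]
    · have h1 : ‖unitFnY x a b x‖ ≤ 1 := by
        rw [unitFnY, Pi.single_eq_same]
        exact (l2_opNorm_single_le a b (1 : ℂ)).trans (le_of_eq norm_one)
      calc k y x * ‖unitFnY x a b x‖ ≤ k y x * 1 := mul_le_mul_of_nonneg_left h1 (hk y x)
        _ = k y x := mul_one _
    · intro x' _ hx'
      rw [unitFnY, Pi.single_eq_of_ne hx', norm_zero, mul_zero]
    · intro h; exact absurd (Finset.mem_univ x) h
  -- each entry of `(adjTrY T Ψ)(x)` is `≤ N²·Σ_y k y x‖Ψ y‖`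
  have hentry : ∀ a b : Fin N, ‖adjTrY T Ψ x a b‖ ≤ (N : ℝ) ^ 2 * ∑ y, k y x * ‖Ψ y‖ := by
    intro a b
    rw [adjTrY_apply]
    unfold trSesqY
    have hy : ∀ y, ‖∑ c, ∑ e, star (T (unitFnY x a b) y c e) * Ψ y c e‖ ≤ (N : ℝ) ^ 2 * (k y x * ‖Ψ y‖) := by
      intro y
      have hce : ∀ c e : Fin N, ‖star (T (unitFnY x a b) y c e) * Ψ y c e‖ ≤ k y x * ‖Ψ y‖ := by
        intro c e
        rw [norm_mul, norm_star]
        exact mul_le_mul ((norm_entry_le_l2_opNorm _ c e).trans (hTunit a b y)) (norm_entry_le_l2_opNorm _ c e) (norm_nonneg _) (hk y x)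
      calc ‖∑ c, ∑ e, star (T (unitFnY x a b) y c e) * Ψ y c e‖ ≤ ∑ c, ‖∑ e, star (T (unitFnY x a b) y c e) * Ψ y c e‖ := norm_sum_le _ _
        _ ≤ ∑ c, ∑ e, ‖star (T (unitFnY x a b) y c e) * Ψ y c e‖ := Finset.sum_le_sum fun c _ => norm_sum_le _ _
        _ ≤ ∑ _c : Fin N, ∑ _e : Fin N, k y x * ‖Ψ y‖ := Finset.sum_le_sum fun c _ => Finset.sum_le_sum fun e _ => hce c e
        _ = (N : ℝ) ^ 2 * (k y x * ‖Ψ y‖) := by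
            rw [Finset.sum_const, Finset.card_univ, Fintype.card_fin, Finset.sum_const, Finset.card_univ, Fintype.card_fin, smul_smul,
              nsmul_eq_mul]
            push_cast; ring
    calc ‖∑ y, ∑ c, ∑ e, star (T (unitFnY x a b) y c e) * Ψ y c e‖ ≤ ∑ y, ‖∑ c, ∑ e, star (T (unitFnY x a b) y c e) * Ψ y c e‖ := norm_sum_le _ _
      _ ≤ ∑ y, (N : ℝ) ^ 2 * (k y x * ‖Ψ y‖) := Finset.sum_le_sum fun y _ => hy y
      _ = (N : ℝ) ^ 2 * ∑ y, k y x * ‖Ψ y‖ := by rw [← Finset.mul_sum]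
  calc ‖adjTrY T Ψ x‖ ≤ ∑ a, ∑ b, ‖adjTrY T Ψ x a b‖ := l2_opNorm_le_sum_norm_entry _
    _ ≤ ∑ _a : Fin N, ∑ _b : Fin N, (N : ℝ) ^ 2 * ∑ y, k y x * ‖Ψ y‖ := Finset.sum_le_sum fun a _ => Finset.sum_le_sum fun b _ => hentry a b
    _ = (N : ℝ) ^ 4 * ∑ y, k y x * ‖Ψ y‖ := by
        rw [Finset.sum_const, Finset.card_univ, Fintype.card_fin, Finset.sum_const, Finset.card_univ, Fintype.card_fin, smul_smul, nsmul_eq_mul]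
        push_cast; ring

end Adjoint

section KnitCube

open scoped Matrix Matrix.Norms.L2Operator

variable {N : ℕ} [Nonempty (Fin N)] (i : KIdx d ℓ hd hL b₀ b₁) (q : ↥(cubes (toKT i).D.toDomains))

/-- ★ **THE COLUMNS OF `Q*_□(1) = (qsKc)♯`**: `‖(Q*_□(1)Ψ)(f)‖ ≤ Σ_ι qKc ι f·‖Ψ ι‖` (`QsknitCubeY_one`, `q*_□ = q_□ᵀ ≥ 0`).
[cite: Balaban1985BackgroundPropagators, (3.13) p.393, Cor. 3.5 p.407 («U = 1»), p.409 l.1–5; Balaban1984PropagatorsI, (1.18) p.20] -/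
theorem norm_QsknitCubeY_one_apply_le (Ψ : IBondCubeY i q → Matrix (Fin N) (Fin N) ℂ) (f : FBondY i) :
    ‖QsknitCubeY i q (fun _ _ => 1) Ψ f‖ ≤ ∑ ι, qKc i q ι f * ‖Ψ ι‖ := by
  rw [QsknitCubeY_one]
  refine (norm_liftMatY_apply_le (qsKc i q) Ψ f).trans (le_of_eq (Finset.sum_congr rfl fun ι _ => ?_))
  rw [qsKc_eq_transpose, Matrix.transpose_apply, abs_of_nonneg (qKc_nonneg i q ι f)]

/-- ★★ **THE COLUMNS OF THE ADJOINT's VARIATION FROM A ROW KERNEL OF `Q_□(Ṽ) − Q_□(1)`**: `Q*_□(Ṽ) − Q*_□(1) = adjTrY (Q_□(Ṽ) − Q_□(1))`, so any row kernel `k ≥ 0` of the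
variation of `Q_□` («F_{2}») is `N⁴` times a column kernel of the variation of `Q*_□` («F*_{2}», «not the adjoint of F₂» — here simply the variation OF the adjoint letter).
[cite: Balaban1985BackgroundPropagators, (3.80)–(3.81) p.406, (3.13) p.393, p.409 l.1–5] -/
theorem norm_QsknitCubeY_sub_one_apply_le_of_rowKernel (V : CfgY (Matrix (Fin N) (Fin N) ℂ) i) (k : IBondCubeY i q → FBondY i → ℝ) (hk : ∀ ι f, 0 ≤ k ι f)
    (hrow : ∀ (Λ : FBondY i → Matrix (Fin N) (Fin N) ℂ) (ι : IBondCubeY i q), ‖QknitCubeY i q V Λ ι - QknitCubeY i q (fun _ _ => 1) Λ ι‖ ≤ ∑ f, k ι f * ‖Λ f‖)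
    (Ψ : IBondCubeY i q → Matrix (Fin N) (Fin N) ℂ) (f : FBondY i) :
    ‖QsknitCubeY i q V Ψ f - QsknitCubeY i q (fun _ _ => 1) Ψ f‖ ≤ (N : ℝ) ^ 4 * ∑ ι, k ι f * ‖Ψ ι‖ := by
  -- `adjTrY (Q V) Ψ f − adjTrY (Q 1) Ψ f = adjTrY (Q V − Q 1) Ψ f`: the trace pairing is additive in its first slot (dag-n06-l's Summits-side `adjTrY_sub`, inlined)
  have e : QsknitCubeY i q V Ψ f - QsknitCubeY i q (fun _ _ => 1) Ψ f = adjTrY (QknitCubeY i q V - QknitCubeY i q (fun _ _ => 1)) Ψ f := by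
    rw [QsknitCubeY_apply, QsknitCubeY_apply]
    ext a c
    simp only [adjTrY_apply, LinearMap.sub_apply, Pi.sub_apply, Matrix.sub_apply, trSesqY, star_sub, sub_mul, Finset.sum_sub_distrib]
  rw [e]
  exact norm_adjTrY_apply_le_of_rowKernel_gen _ k hk (fun Λ ι => by simpa only [LinearMap.sub_apply, Pi.sub_apply] using hrow Λ ι) Ψ f

end KnitCube

end Literature.MathematicalPhysics.QuantumFieldTheory.Balaban1983to89.B9Eq381KnitCubeBoxKernelY

end
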